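import Summits.AtomisticToContinuum.HydrodynamicLimit.Theorems.CollisionIsometryCLTDiffuseBackwardInfluencePairProcess
import Summits.AtomisticToContinuum.HydrodynamicLimit.Theorems.CollisionIsometryCLTDiffuseBackwardInfluencePairAlong
import Summits.AtomisticToContinuum.HydrodynamicLimit.Theorems.CollisionIsometryCLTDiffuseBackwardInfluencePairDelayedDefs
import HarnessLib

/-!
# `DiffuseBackwardInfluence`, line `share-nondegeneracy-one-flight`, stub `stub_pairPathBoundT` (lead c6), 1/3: DOMINATION
of the old-tag apart mass of the marked pair process by the canonical no-inflow transport `apartFrom`, and the split of the lag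
payments `lagAt` into the step's total merge mass (recent excursions, lag `1`) and `S ×` the DELAYED re-merge flow, itself dominated by
`delayedRemAt` (skeleton v8; crux stmt-AtomisticToContinuum-12950, `--supports`).
-/

namespace Summit.AtomisticToContinuum.HydrodynamicLimit.Theorems.DiffuseBackwardInfluenceShare

open scoped BigOperators Topology ENNReal InnerProductSpace Classical
open Filter Set MeasureTheory
open Literature.Analysis.FluidPDE (Config HardSphereFlow collidePair)
open Literature.MathematicalPhysics.KineticTheory (localGibbsLaw hsDiameter)
open Summit.AtomisticToContinuum.HydrodynamicLimit.Theorems.DiffuseBackwardInfluenceNeg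

noncomputable section

namespace PairPath

section Dominate

variable {N : ℕ} {C : OnePath.Src N}

/-! ### §A The canonical no-inflow transport of the source, as a function of `OnePath.Src` -/

variable (C) in
/-- `apartFrom` of the source on its own grid: pairs apart since the start of slot `r`, `t` steps later. -/
def apF (r t : ℕ) (i j : Fin (N + 1)) : ℝ := apartFrom C.σ N C.y C.k C.Δ (S C) r t i j

/-- `apF` at `t = 0` is the product law off the diagonal (definitional). [folklore] -/
theorem apF_zero (r : ℕ) (i j : Fin (N + 1)) :
    apF C r 0 i j = if i = j then 0 else OnePath.mu C (OnePath.nS C r) i * OnePath.mu C (OnePath.nS C r) j := rfl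

/-- `apF` vanishes on the diagonal. [folklore] -/
theorem apF_diag (r t : ℕ) (i : Fin (N + 1)) : apF C r t i i = 0 := by
  cases t <;> simp [apF, apartFrom]

/-- One more step of `apF` (definitional, kernel in `K` form). [folklore] -/
theorem apF_succ (r t : ℕ) (i j : Fin (N + 1)) :
    apF C r (t + 1) i j = if i = j then 0 else
      ∑ i', ∑ j', apF C r t i' j' * (PairPath.K C (OnePath.nS C r + t) i' i * PairPath.K C (OnePath.nS C r + t) j' j) := rfl

/-- `apF` is nonnegative. [folklore] -/
theorem apF_nonneg (r : ℕ) : ∀ t i j, 0 ≤ apF C r t i j := by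
  intro t
  induction t with
  | zero =>
    intro i j
    rw [apF_zero]
    split_ifs
    · exact le_rfl
    · exact mul_nonneg (OnePath.mu_nonneg _ _) (OnePath.mu_nonneg _ _)
  | succ t ih =>
    intro i j
    rw [apF_succ]
    split_ifs
    · exact le_rfl
    · exact Finset.sum_nonneg fun i' _ => Finset.sum_nonneg fun j' _ =>
        mul_nonneg (ih i' j') (mul_nonneg (K_nonneg _ _ _) (K_nonneg _ _ _))

/-- At an idle step `apF` does not move. [folklore] -/
theorem apF_succ_of_not {r t : ℕ} (h : ¬ (pairsAt C.σ N C.y (OnePath.nS C r + t)).Nonempty) (i j : Fin (N + 1)) :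
    apF C r (t + 1) i j = apF C r t i j := by
  rw [apF_succ]
  by_cases hij : i = j
  · rw [if_pos hij, hij, apF_diag]
  · rw [if_neg hij]
    simp only [K_of_not h]
    rw [Finset.sum_eq_single i (fun i' _ hi' => Finset.sum_eq_zero fun j' _ => by simp [Ne.symm hi'])
      (fun hi => absurd (Finset.mem_univ i) hi)]
    rw [Finset.sum_eq_single j (fun j' _ hj' => by simp [Ne.symm hj']) (fun hj => absurd (Finset.mem_univ j) hj)]
    simp

/-! ### §B A started slot index is below the started-slot counter -/

/-- If slot `r < S` has started by step `n` then `r < cnt n` (all earlier slots have started too). [folklore] -/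
theorem lt_cnt_of_nS_le (hΔ : 0 < C.Δ) (hpos : 0 < OnePath.fin C) {r n : ℕ} (hr : r < S C)
    (hn : OnePath.nS C r ≤ n) : r < cnt C n := by
  have hS : 0 < 2 * C.m * C.L := lt_of_le_of_lt (Nat.zero_le r) hr
  have hsub : Finset.range (r + 1) ⊆ (Finset.range (S C)).filter fun r' => OnePath.nS C r' ≤ n := by
    intro r' hr'
    rw [Finset.mem_range] at hr'
    rw [Finset.mem_filter, Finset.mem_range]
    refine ⟨lt_of_le_of_lt (Nat.lt_succ_iff.1 hr') hr, le_trans ?_ hn⟩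
    exact OnePath.slotStart_mono hΔ hpos hS (Nat.lt_succ_iff.1 hr') hr.le
  have := Finset.card_le_card hsub
  rw [Finset.card_range] at this
  unfold cnt
  omega

/-! ### §C Domination of the old-tag apart mass -/

/-- DOMINATION: `t` steps after the start of slot `r`, the apart mass whose tag is `≤ r` (pairs whose current separation began before
slot `r` started) is at most the canonical no-inflow transport `apF r t` (box `K + 2`, for steps `≤ K`). [folklore] -/
theorem sAle_le_apF (hΔ : 0 < C.Δ) (hpos : 0 < OnePath.fin C) {r : ℕ} (hr : r < S C) (K : ℕ) :
    ∀ t, OnePath.nS C r + t ≤ K → ∀ i j, sAle (K + 2) r (Am C (OnePath.nS C r + t)) i j ≤ apF C r t i j := by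
  intro t
  induction t with
  | zero =>
    intro hK i j
    rw [apF_zero]
    change sAle (K + 2) r (Am C (OnePath.nS C r)) i j ≤ _
    have hmarg := (marginal (C := C) K (OnePath.nS C r) (by omega)).2 i j
    calc sAle (K + 2) r (Am C (OnePath.nS C r)) i j ≤ sA (K + 2) (S C) (Am C (OnePath.nS C r)) i j := by
          unfold sAle sA
          refine Finset.sum_le_sum fun s _ => Finset.sum_le_sum fun t _ => ?_
          exact Finset.sum_le_sum_of_subset_of_nonneg (Finset.range_subset_range.2 (by omega))
            (fun g _ _ => Am_nonneg _ _ _ _ _ _)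
      _ = _ := hmarg
  | succ t ih =>
    intro hK i j
    have ih' := ih (by omega)
    rw [show OnePath.nS C r + (t + 1) = OnePath.nS C r + t + 1 from rfl]
    by_cases h : (pairsAt C.σ N C.y (OnePath.nS C r + t)).Nonempty
    · rw [Am_succ_of h, sAle_stepA (some_fst_ne_some_snd h) _ _ (lt_cnt_of_nS_le hΔ hpos hr (Nat.le_add_right _ _)),
        apF_succ]
      simp only [K_eq_kstep_of h]
      exact offdiag_transport_mono (OnePath.fr_nonneg _ _) (OnePath.fr_le_one _ _) (OnePath.fr_nonneg _ _)
        (OnePath.fr_le_one _ _) ih' i j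
    · rw [Am_succ_of_not h, apF_succ_of_not h]
      exact ih' i j

/-! ### §D The delayed part of the lag payment is dominated by `delayedRemAt` -/

variable (C) in
/-- The DELAYED re-merge flow of step `c` (box `K + 2`): the re-merge flow of the apart mass with tag `≤ cnt c − 2` (lag `≥ 2`). -/
def delFlow (K c : ℕ) : ℝ :=
  if h : (pairsAt C.σ N C.y c).Nonempty then
    ∑ g ∈ Finset.range (cnt C c - 1), remFlowTag h.some.1 h.some.2 (OnePath.fr C c) (K + 2) (Am C c) g
  else 0

/-- `remFlowTag` is nonnegative. [folklore] -/
theorem remFlowTag_nonneg {c : ℕ} (h : (pairsAt C.σ N C.y c).Nonempty) (K g : ℕ) :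
    0 ≤ remFlowTag h.some.1 h.some.2 (OnePath.fr C c) (K + 2) (Am C c) g := by
  unfold remFlowTag
  refine Finset.sum_nonneg fun i _ => Finset.sum_nonneg fun i' _ => Finset.sum_nonneg fun j' _ => mul_nonneg ?_ ?_
  · exact Finset.sum_nonneg fun s _ => Finset.sum_nonneg fun t _ => Am_nonneg _ _ _ _ _ _
  · have h0 := OnePath.fr_nonneg (C := C) c; have h1 := OnePath.fr_le_one (C := C) c
    exact mul_nonneg (kstep_nonneg (h0 _) (h1 _) (h0 _) (h1 _) _ _) (kstep_nonneg (h0 _) (h1 _) (h0 _) (h1 _) _ _)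

/-- `delFlow` is nonnegative. [folklore] -/
theorem delFlow_nonneg (K c : ℕ) : 0 ≤ delFlow C K c := by
  unfold delFlow
  split_ifs with h
  · exact Finset.sum_nonneg fun g _ => remFlowTag_nonneg h K g
  · exact le_rfl

/-- A step `c` of the window with `cnt c = r + 1` lies in slot `r`. [folklore] -/
theorem mem_slot_of_cnt (hΔ : 0 < C.Δ) (hpos : 0 < OnePath.fin C) {c r : ℕ} (hc : c < OnePath.fin C)
    (hcnt : cnt C c = r + 1) : OnePath.nS C r ≤ c ∧ c < OnePath.nS C (r + 1) ∧ r < S C := by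
  have hrS : r < S C := by have := cnt_le (C := C) c; omega
  have hS : 0 < 2 * C.m * C.L := lt_of_le_of_lt (Nat.zero_le r) hrS
  have h1 : OnePath.nS C r ≤ c := by
    by_contra hlt
    push Not at hlt
    -- if slot r had not started, cnt c ≤ r
    have hsub : (Finset.range (S C)).filter (fun r' => OnePath.nS C r' ≤ c) ⊆ Finset.range r := by
      intro r' hr'
      rw [Finset.mem_filter, Finset.mem_range] at hr'
      rw [Finset.mem_range]
      by_contra hge
      push Not at hge
      have := OnePath.slotStart_mono hΔ hpos hS hge (by unfold S at hr'; omega)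
      unfold OnePath.nS at hlt hr'
      omega
    have := Finset.card_le_card hsub
    rw [Finset.card_range] at this
    unfold cnt at hcnt
    omega
  refine ⟨h1, ?_, hrS⟩
  by_contra hge
  push Not at hge
  by_cases hr1 : r + 1 < S C
  · have := lt_cnt_of_nS_le hΔ hpos hr1 hge
    omega
  · have hr1' : r + 1 = S C := by omega
    rw [hr1'] at hge
    unfold OnePath.nS S at hge
    rw [OnePath.slotStart_self hS] at hge
    unfold OnePath.fin at hc
    omega

/-- THE DELAYED FLOW IS DOMINATED BY `delayedRemAt`: at a step `c ≤ K` of the window with `cnt c ≥ 2` (slot `r = cnt c − 1 ≥ 1`), the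
re-merge flow of the apart mass with tag `≤ r − 1` is at most the re-merge flow of the canonical transport started at slot `r − 1`. [folklore] -/
theorem delFlow_le_delayedRemAt (hΔ : 0 < C.Δ) (hpos : 0 < OnePath.fin C) {K c : ℕ} (hcK : c ≤ K) (hc : c < OnePath.fin C)
    (h2 : 2 ≤ cnt C c) :
    delFlow C K c ≤ delayedRemAt C.σ N C.y C.k C.Δ (S C) (cnt C c - 1) (c - OnePath.nS C (cnt C c - 1)) := by
  set r := cnt C c - 1 with hr
  have hcnt : cnt C c = r + 1 := by omega
  obtain ⟨h1, _, hrS⟩ := mem_slot_of_cnt hΔ hpos hc hcnt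
  have hS : 0 < 2 * C.m * C.L := lt_of_le_of_lt (Nat.zero_le r) hrS
  have hr1 : 1 ≤ r := by omega
  have hmono : OnePath.nS C (r - 1) ≤ OnePath.nS C r :=
    OnePath.slotStart_mono hΔ hpos hS (Nat.sub_le r 1) (by unfold S at hrS; omega)
  -- the canonical quantity, rewritten at step c
  have hlen : OnePath.nS C r - OnePath.nS C (r - 1) + (c - OnePath.nS C r) = c - OnePath.nS C (r - 1) := by omega
  have hidx : OnePath.nS C (r - 1) + (c - OnePath.nS C (r - 1)) = c := by omega
  have hcan : delayedRemAt C.σ N C.y C.k C.Δ (S C) r (c - OnePath.nS C r) =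
      ∑ i, ∑ i', ∑ j', apF C (r - 1) (c - OnePath.nS C (r - 1)) i' j' * (PairPath.K C c i' i * PairPath.K C c j' i) := by
    unfold delayedRemAt apF PairPath.K
    simp only []
    unfold OnePath.nS at hlen hidx ⊢
    unfold S
    rw [hlen, hidx]
  rw [hcan]
  unfold delFlow
  by_cases h : (pairsAt C.σ N C.y c).Nonempty
  · rw [dif_pos h]
    -- the tagged flows with g ≤ r - 1 are the flow of `sAle (K+2) (r-1)`
    have hsum : ∑ g ∈ Finset.range (cnt C c - 1), remFlowTag h.some.1 h.some.2 (OnePath.fr C c) (K + 2) (Am C c) g =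
        ∑ i, ∑ i', ∑ j', sAle (K + 2) (r - 1) (Am C c) i' j' *
          (kstep h.some.1 h.some.2 (OnePath.fr C c) i' i * kstep h.some.1 h.some.2 (OnePath.fr C c) j' i) := by
      unfold remFlowTag sAle
      rw [show cnt C c - 1 = r - 1 + 1 by omega]
      rw [Finset.sum_comm]
      refine Finset.sum_congr rfl fun i _ => ?_
      rw [Finset.sum_comm]
      refine Finset.sum_congr rfl fun i' _ => ?_
      rw [Finset.sum_comm]
      refine Finset.sum_congr rfl fun j' _ => ?_
      rw [← Finset.sum_mul]
      congr 1
      rw [Finset.sum_comm]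
      refine Finset.sum_congr rfl fun s _ => ?_
      rw [Finset.sum_comm]
    rw [hsum]
    simp only [K_eq_kstep_of h]
    have hdom := sAle_le_apF hΔ hpos (r := r - 1) (by omega) K (c - OnePath.nS C (r - 1)) (by omega)
    rw [hidx] at hdom
    exact remerge_flow_mono (OnePath.fr_nonneg _ _) (OnePath.fr_le_one _ _) (OnePath.fr_nonneg _ _)
      (OnePath.fr_le_one _ _) hdom
  · rw [dif_neg h]
    exact Finset.sum_nonneg fun i _ => Finset.sum_nonneg fun i' _ => Finset.sum_nonneg fun j' _ =>
      mul_nonneg (apF_nonneg _ _ _ _) (mul_nonneg (K_nonneg _ _ _) (K_nonneg _ _ _))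

/-! ### §E The lag payment splits into the total merge mass (recent excursions) and `S ×` the delayed flow -/

/-- THE LAG SPLIT: `lagAt c ≤ mergeAt c + S · delFlow c` — a re-merge with lag `0` pays nothing, with lag `1` (recent excursion) at most
its own mass (bounded by the step's total merge mass), with lag `≥ 2` (delayed) at most `S` times its mass. [folklore] -/
theorem lagAt_le {K c : ℕ} (hcK : c ≤ K) : lagAt C K c ≤ mergeAt C.σ N C.y C.k c + (S C : ℝ) * delFlow C K c := by
  unfold lagAt delFlow
  by_cases h : (pairsAt C.σ N C.y c).Nonempty
  · rw [dif_pos h, dif_pos h, ← remFlow_eq_mergeAt hcK h, ← sum_remFlowTag]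
    set F : ℕ → ℝ := fun g => remFlowTag h.some.1 h.some.2 (OnePath.fr C c) (K + 2) (Am C c) g with hF
    have hF0 : ∀ g, 0 ≤ F g := fun g => remFlowTag_nonneg h K g
    have hFz : ∀ g, cnt C c < g → F g = 0 := by
      intro g hg
      simp only [hF, remFlowTag]
      refine Finset.sum_eq_zero fun i _ => Finset.sum_eq_zero fun i' _ => Finset.sum_eq_zero fun j' _ => ?_
      rw [Finset.sum_eq_zero fun s _ => Finset.sum_eq_zero fun t _ => Am_eq_zero_of_cnt_lt c i' j' s t hg, zero_mul]
    have hcS : cnt C c ≤ S C := cnt_le c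
    -- termwise bound
    have hterm : ∀ g ∈ Finset.range (S C + 1), ((cnt C c : ℝ) - (g : ℝ)) * F g ≤
        (if g = cnt C c - 1 ∧ 1 ≤ cnt C c then F g else 0) + (S C : ℝ) * (if g < cnt C c - 1 then F g else 0) := by
      intro g _
      by_cases hlt : g < cnt C c - 1
      · rw [if_pos hlt, if_neg (by omega)]
        have : ((cnt C c : ℝ) - (g : ℝ)) ≤ (S C : ℝ) := by
          have : (g : ℝ) ≥ 0 := Nat.cast_nonneg g
          have : (cnt C c : ℝ) ≤ (S C : ℝ) := by exact_mod_cast hcS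
          linarith
        nlinarith [hF0 g]
      · rw [if_neg hlt, mul_zero, add_zero]
        by_cases heq : g = cnt C c - 1 ∧ 1 ≤ cnt C c
        · rw [if_pos heq]
          have : ((cnt C c : ℝ) - (g : ℝ)) = 1 := by
            rw [heq.1, Nat.cast_sub heq.2]; push_cast; ring
          rw [this, one_mul]
        · rw [if_neg heq]
          by_cases hgt : cnt C c < g
          · rw [hFz g hgt, mul_zero]
          · have hge : g = cnt C c := by omega
            rw [hge, sub_self, zero_mul]
    refine (Finset.sum_le_sum hterm).trans ?_
    rw [Finset.sum_add_distrib, ← Finset.mul_sum]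
    refine add_le_add ?_ ?_
    · -- the recent part is at most the total flow
      by_cases h1 : 1 ≤ cnt C c
      · have hmem : cnt C c - 1 ∈ Finset.range (S C + 1) := Finset.mem_range.2 (by omega)
        rw [Finset.sum_ite, Finset.sum_const_zero, add_zero]
        calc ∑ g ∈ (Finset.range (S C + 1)).filter (fun g => g = cnt C c - 1 ∧ 1 ≤ cnt C c), F g
            ≤ ∑ g ∈ Finset.range (S C + 1), F g :=
              Finset.sum_le_sum_of_subset_of_nonneg (Finset.filter_subset _ _) fun g _ _ => hF0 g
          _ = _ := rfl
      · rw [Finset.sum_eq_zero fun g _ => if_neg (fun hh => h1 hh.2)]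
        exact Finset.sum_nonneg fun g _ => hF0 g
    · refine mul_le_mul_of_nonneg_left ?_ (Nat.cast_nonneg _)
      rw [Finset.sum_ite, Finset.sum_const_zero, add_zero]
      refine Finset.sum_le_sum_of_subset_of_nonneg ?_ fun g _ _ => hF0 g
      intro g hg
      rw [Finset.mem_filter, Finset.mem_range] at hg
      exact Finset.mem_range.2 hg.2
  · rw [dif_neg h, dif_neg h, mul_zero, add_zero]
    exact OnePath.mergeAt_src_nonneg (C := C) c

/-! ### §F Summing the delayed flows over the window -/

/-- Partition of an initial segment along a monotone sequence of cut points. [folklore] -/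
theorem sum_range_eq_sum_slots (a : ℕ → ℕ) (ha : ∀ r, a r ≤ a (r + 1)) (f : ℕ → ℝ) (S₀ : ℕ) :
    ∑ c ∈ Finset.range (a S₀), f c = ∑ c ∈ Finset.range (a 0), f c +
      ∑ r ∈ Finset.range S₀, ∑ c ∈ Finset.Ico (a r) (a (r + 1)), f c := by
  induction S₀ with
  | zero => simp
  | succ S₀ ih =>
    rw [Finset.sum_range_succ, ← add_assoc, ← ih, Finset.range_eq_Ico, Finset.range_eq_Ico]
    have h0 : a 0 ≤ a S₀ := monotone_nat_of_le_succ ha (Nat.zero_le _)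
    exact (Finset.sum_Ico_consecutive f (Nat.zero_le _) (ha S₀)).symm

/-- THE DELAYED FLOWS OF THE WINDOW ARE DOMINATED BY THE CANONICAL DELAYED RE-MERGE MASS of the source. [folklore] -/
theorem sum_delFlow_le (hΔ : 0 < C.Δ) (hpos : 0 < OnePath.fin C) (hm : 1 ≤ C.m) (hL : 1 ≤ C.L) {K : ℕ}
    (hK : OnePath.fin C ≤ K) :
    ∑ c ∈ Finset.range (OnePath.fin C), delFlow C K c ≤
      ∑ r ∈ Finset.Ico 1 (S C), ∑ t ∈ Finset.range (OnePath.nS C (r + 1) - OnePath.nS C r),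
        delayedRemAt C.σ N C.y C.k C.Δ (S C) r t := by
  have hS : 0 < 2 * C.m * C.L := S_pos hm hL
  have hmono : ∀ r, OnePath.nS C (min r (S C)) ≤ OnePath.nS C (min (r + 1) (S C)) := fun r =>
    OnePath.slotStart_mono hΔ hpos hS (min_le_min_right _ (Nat.le_succ r)) (min_le_right _ _)
  have hfin : OnePath.fin C = OnePath.nS C (min (S C) (S C)) := by
    rw [min_self]; unfold OnePath.nS OnePath.fin S; exact (OnePath.slotStart_self hS).symm
  rw [hfin, sum_range_eq_sum_slots (fun r => OnePath.nS C (min r (S C))) hmono _ (S C)]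
  simp only [Nat.zero_min]
  -- steps before slot 0 and in slot 0 carry no delayed flow; slots r ≥ 1 are reindexed
  have hzero : ∀ c, c < OnePath.nS C 1 → c < OnePath.fin C → delFlow C K c = 0 := by
    intro c hc hcf
    unfold delFlow
    split_ifs with h
    · have : cnt C c ≤ 1 := by
        by_contra hgt
        push Not at hgt
        obtain ⟨h1, _, _⟩ := mem_slot_of_cnt hΔ hpos hcf (r := cnt C c - 1) (by omega)
        have := OnePath.slotStart_mono hΔ hpos hS (show 1 ≤ cnt C c - 1 by omega)
          (show cnt C c - 1 ≤ 2 * C.m * C.L by have := cnt_le (C := C) c; unfold S at this; omega)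
        unfold OnePath.nS at h1 hc
        omega
      rw [show cnt C c - 1 = 0 by omega, Finset.range_zero, Finset.sum_empty]
    · rfl
  have hn1 : OnePath.nS C 0 ≤ OnePath.nS C 1 := OnePath.slotStart_mono hΔ hpos hS (Nat.zero_le 1) hS
  have hn1f : OnePath.nS C 1 ≤ OnePath.fin C := by
    unfold OnePath.nS OnePath.fin; rw [← OnePath.slotStart_self (σ := C.σ) (y := C.y) (Δ := C.Δ) hS]
    exact OnePath.slotStart_mono hΔ hpos hS hS le_rfl
  rw [Finset.sum_eq_zero fun c hc => hzero c (lt_of_lt_of_le (Finset.mem_range.1 hc) hn1)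
    (lt_of_lt_of_le (Finset.mem_range.1 hc) (hn1.trans hn1f)), zero_add]
  rw [Finset.range_eq_Ico, ← Finset.sum_Ico_consecutive _ (Nat.zero_le 1) (show 1 ≤ S C from hS)]
  have hslot0 : ∑ r ∈ Finset.Ico 0 1, ∑ c ∈ Finset.Ico (OnePath.nS C (min r (S C))) (OnePath.nS C (min (r + 1) (S C))),
      delFlow C K c = 0 := by
    rw [Finset.sum_Ico_succ_top (Nat.zero_le 0), Finset.Ico_self, Finset.sum_empty, zero_add]
    simp only [Nat.zero_min, zero_add, min_eq_left (show 1 ≤ S C from hS)]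
    exact Finset.sum_eq_zero fun c hc => hzero c (Finset.mem_Ico.1 hc).2
      (lt_of_lt_of_le (Finset.mem_Ico.1 hc).2 hn1f)
  rw [hslot0, zero_add]
  refine Finset.sum_le_sum fun r hr => ?_
  rw [Finset.mem_Ico] at hr
  rw [min_eq_left hr.2.le, min_eq_left hr.2, Finset.sum_Ico_eq_sum_range]
  refine Finset.sum_le_sum fun t ht => ?_
  rw [Finset.mem_range] at ht
  have hcf : OnePath.nS C r + t < OnePath.fin C := by
    have : OnePath.nS C (r + 1) ≤ OnePath.fin C := by
      unfold OnePath.nS OnePath.fin; rw [← OnePath.slotStart_self (σ := C.σ) (y := C.y) (Δ := C.Δ) hS]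
      exact OnePath.slotStart_mono hΔ hpos hS hr.2 le_rfl
    omega
  have hcnt : cnt C (OnePath.nS C r + t) = r + 1 :=
    cnt_eq_succ_of_mem_slot hΔ hpos hr.2 (Nat.le_add_right _ _) (by omega)
  have h := delFlow_le_delayedRemAt hΔ hpos (K := K) (by omega) hcf (by omega)
  rw [hcnt, Nat.add_sub_cancel, Nat.add_sub_cancel_left] at h
  exact h

end Dominate

/-- REGISTERED HEADLINE (sub-goal `pairPath_lagAt_le`): the lag split. [folklore] -/
theorem pairPath_lagAt_le : ∀ (N : ℕ) (C : OnePath.Src N) (K c : ℕ), c ≤ K → PairPath.lagAt C K c ≤ mergeAt C.σ N C.y C.k c + (PairPath.S C : ℝ) * PairPath.delFlow C K c :=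
  fun _ _ _ _ hcK => lagAt_le hcK

end PairPath

end

end Summit.AtomisticToContinuum.HydrodynamicLimit.Theorems.DiffuseBackwardInfluenceShare
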